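import Summits.AnomalousDissipation.AnomalousDissipation.Theorems.BaireTransferRobustLoudUpgradeWildResidual

/-!
# Line `malkin-cone-group-orbits`, COMPANION skeleton c6 (lead `…-1144-c6-0`) for the crux `BaireTransfer.RobustLoudUpgrade`
# (stmt-AnomalousDissipation-1144): THE EXACT RESIDUAL — skeleton v1

Companion of the generation-1 skeleton v5 (`Lines/malkin_cone_group_orbits.lean`) and of c1–c5 (`…_c1.lean` … `…_c5.lean`).  This
file does NOT reshape those skeletons.  State of the line when this seat opened (2026-08-16T23:33Z): EVERY registered stub of
v2–v5/c1–c5 except the residuals is LANDED under `Theorems/BaireTransferRobustLoudUpgrade*.lean` (≈80 `--supports` files), glued by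
`Unfolding.line_glue_c5` over the maximal tame union `tameUnfold` (`…LineUnfoldingDefs.lean`, p131399):

  `tameUnfold = tameScaling ∪ persistSteadyNear ∪ unfoldSteady`,  `tameScaling = tamePeriodic4 ∪ scalingCrossing{Steady,Periodic} ∪
  radial{Steady,Periodic}`,  `tamePeriodic4 ⊇ … ⊇ tameCrossing2 ⊇ tameCrossing ⊇ tameLeaf = nondegSteadyLeaf ∪ persistSteadyLeaf ∪
  censusSteady ∪ malkinSteady ∪ borderedSteady ∪ persistPeriodic` (+ crossings, robust crossings, subharmonic pitchforks, folds,
  indefinite points, Malkin/bordered/fold/saddle classes of cycles), and `tameUnfold ⊆ closure (interior LOUD)` at the same strict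
  budgets is a THEOREM (`Unfolding.tameUnfold_subset_closure_interior_loud`).

What this companion adds (landed as `Theorems/BaireTransferRobustLoudUpgradeWildResidual.lean`, p132214):
* `WildResidual.RobustLoudUpgrade_iff_wild` — the crux is EQUIVALENT to its WILD RESIDUAL, the crux's own inclusion asked only of
  the loud forces that are not limits of tame-witnessed forces at the relaxed budgets.  The earlier registered residuals
  (`stub_residual_c2b … stub_residual_c5 : loud ⊆ closure (tame… (2E) (ε/2))`) are sufficient but stronger in form;
  `WildResidual.residual_c6_of_c5` shows nothing registered is lost.
* `WildResidual.baireTarget_of_dense_tame` — the route target from DENSITY OF TAME-LOUD forces, with no upgrade crux (planner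
  side-deliverable: the typed alternative to the pair crux #2 + crux #3).
* the registered sub-goal `WildResidual.line_glue_c6` (wild residual → crux BY NAME).

Open: `stub_residual_c6` below — by `RobustLoudUpgrade_iff_wild` it IS the crux modulo the landed theorems (crux-sized by
construction; handed back with `promote-stub`).  Its content in words: no open ball of forces `B ⊆ P_S` contains a loud force
(sharp budgets) while every force of `B` is relaxed-quiet or carries only TOTALLY RIGID relaxed-loud witnesses (isolated, Leray–Schauder
index 0, first-order invisible to `P_S ⊕ ℝ∂_ν ⊕ ℝ³∂_m (⊕ ℝ∂_τ)` with negative-definite Lyapunov–Schmidt discriminant — the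
"elliptic ghost"); equivalently (c4's `category_transfer`, granted `LOUD_j` is `F_σ`) relaxed loudness is nowhere meagre near every
loud force.  A finite-family Kupka–Smale / robust designer-zeroth-law statement for 3-D NS; open.
-/

set_option linter.dupNamespace false

noncomputable section

open scoped Topology
open Filter Set Function TopologicalSpace

namespace Summit.AnomalousDissipation.AnomalousDissipation.Theorems.RobustLoudUpgrade

open Summit.AnomalousDissipation.AnomalousDissipation.Theses.BaireTransfer
open Summit.AnomalousDissipation.AnomalousDissipation.Theorems.RobustLoudUpgrade.Unfolding
open Summit.AnomalousDissipation.AnomalousDissipation.Theorems.RobustLoudUpgrade.WildResidual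

namespace WildResidual

/-! ## §1 The one open stub: the wild residual (≡ the crux modulo the landed tame classes) -/

/-- **stub_residual_c6** (the EXACT residual of the line; crux-sized because EQUIVALENT to the crux by
`WildResidual.RobustLoudUpgrade_iff_wild`): for some finite stock `S₀`, in every family `P_S`, `S ⊇ S₀`, at every pair of budgets and
every level, the loud forces that are NOT limits of tame-witnessed forces at the relaxed budgets lie in the closure of the robustly
relaxed-loud forces.  Open content: elliptic ghosts (steady or periodic), kernels of dimension ≥ 2 beyond the intrinsic borders,
rigid continua — the finite-family Kupka–Smale problem of the route card. [folklore] -/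
theorem stub_residual_c6 :
    ∃ S₀ : Finset (Fin 3 → ℤ), ∀ S : Finset (Fin 3 → ℤ), S₀ ⊆ S → ∀ (E ε : ℝ), 0 < ε → ∀ j : ℕ,
      loud S (1 / ((j : ℝ) + 1)) E ε \ closure (tameUnfold S (1 / ((j : ℝ) + 1)) (2 * E) (ε / 2)) ⊆
        closure (interior (loud S (1 / ((j : ℝ) + 1)) (2 * E) (ε / 2))) := by
  sorry

/-! ## §2 Bookkeeping (sorry-free): the earlier residuals imply this one; this one is implied by the crux -/

/-- The reshape c5 → c6 only WEAKENS the residual: the registered `stub_residual_c5` (over `tameUnfold`, stock `unitStock`, every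
ceiling) implies `stub_residual_c6`. [folklore] -/
theorem residual_c6_of_c5'
    (h5 : ∀ S : Finset (Fin 3 → ℤ), unitStock ⊆ S → ∀ (a E ε : ℝ), 0 < a → 0 < ε →
      loud S a E ε ⊆ closure (tameUnfold S a (2 * E) (ε / 2))) :
    ∃ S₀ : Finset (Fin 3 → ℤ), ∀ S : Finset (Fin 3 → ℤ), S₀ ⊆ S → ∀ (E ε : ℝ), 0 < ε → ∀ j : ℕ,
      loud S (1 / ((j : ℝ) + 1)) E ε \ closure (tameUnfold S (1 / ((j : ℝ) + 1)) (2 * E) (ε / 2)) ⊆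
        closure (interior (loud S (1 / ((j : ℝ) + 1)) (2 * E) (ε / 2))) :=
  residual_c6_of_c5 h5

/-- Conversely the residual of this companion is NECESSARY: the crux implies it (so `stub_residual_c6 ↔ RobustLoudUpgrade`).
[folklore] -/
theorem residual_c6_of_crux (h : RobustLoudUpgrade) :
    ∃ S₀ : Finset (Fin 3 → ℤ), ∀ S : Finset (Fin 3 → ℤ), S₀ ⊆ S → ∀ (E ε : ℝ), 0 < ε → ∀ j : ℕ,
      loud S (1 / ((j : ℝ) + 1)) E ε \ closure (tameUnfold S (1 / ((j : ℝ) + 1)) (2 * E) (ε / 2)) ⊆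
        closure (interior (loud S (1 / ((j : ℝ) + 1)) (2 * E) (ε / 2))) :=
  wild_of_RobustLoudUpgrade h

/-! ## §3 Composition (sorry-free): the crux BY NAME -/

/-- **Composition (companion c6): the registered stub proves the crux `RobustLoudUpgrade` BY NAME** — the registered line glue
`line_glue_c6` applied to the wild residual. [folklore] -/
theorem RobustLoudUpgrade_of : RobustLoudUpgrade :=
  line_glue_c6 stub_residual_c6

end WildResidual

end Summit.AnomalousDissipation.AnomalousDissipation.Theorems.RobustLoudUpgrade

end
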